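import Mathlib
import Summits.Ventures.HodgeRepro.Tier4.Line4.LevelIntersectionGA
import Summits.Ventures.HodgeRepro.Tier4.Line4.FinitePlacePositivity
import Summits.Ventures.HodgeRepro.Tier4.Line4.SuppMeasure

/-!
# Tier4/Line4/LevelShrink — C-L4-LEVELINTER (2): the level double cosets along `p`-powers shrink to `K^{(p)} γ₀ K^{(p)}`,
and the level fibre of the (7b) witness enters every neighbourhood of its limit

Blind re-derivation cell `pub-hodge-repro`, Tier 4 «prove the step» (README §9–§10), seat t4-L4-p1 (prover, LINE L4,
gen 4; plan-4 g5's (1) S15484).  Tree path `lean/Summits/Ventures/HodgeRepro/Tier4/Line4/LevelShrink.lean`.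
Mathlib-level; no literature.

WHAT IS PROVED.
* `levelKInf W p := ⨅ N, levelK W (p^N)` — the group `K^{(p)}` (`mem_levelKInf_iff`; = «`1` at `p`, integral away from
  `p`» by LevelIntersectionGA's `mem_levelK_pow_forall_iff`);
* `mem_iInter_levelDoubleCoset_pow_iff` — `x ∈ ⋂_N K(p^N) γ₀ K(p^N)` iff `x ∈ K^{(p)} γ₀ K^{(p)}` (nested compact
  sets of factorisations `a γ₀ c = x`, Cantor's intersection theorem);
* `exists_levelDoubleCoset_pow_subset` — **the shrinking**: for every open `U ⊇ K^{(p)} γ₀ K^{(p)}` there is `N₀` with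
  `K(p^N) γ₀ K(p^N) ⊆ U` for all `N ≥ N₀` (the closed sets `K(p^N) γ₀ K(p^N) ∖ U` are nested in a compact with empty
  intersection);
* `exists_suppSet_pow_subset` — the same for the level fibre `suppSet γ₀ (p^N) γ` of the (7b) witness: it lies in the
  preimage of `U` under the continuous orbit map `(b, b′) ↦ b⁻¹ γ_f b′` from `N₀` on.
So the fibre along `p`-powers converges to the `K^{(p)}`-fibre — NOT to the stabiliser pairs (F-L4-PHASE-PPOWER).

Nothing here says anything about the status of the Hodge conjecture for CM abelian varieties, which is NOT proved
(HC_CM is NOT proved by anyone in this repository).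
-/

set_option autoImplicit false

noncomputable section

namespace Summit.Ventures.HodgeRepro.Tier4.Line4

open Summit.Ventures.HodgeRepro.Tier4.Common Summit.Ventures.HodgeRepro.Tier4.Line1 NumberField Topology
open scoped Pointwise

section Shrink

variable {k : Type} [Field k] [NumberField k] (W : PlaneData k)

/-- **The group `K^{(p)} = ⋂_N K(p^N)`** («`1` at `p`, integral away from `p`», LevelIntersectionGA). -/
def levelKInf (p : ℕ) : Subgroup (GA W) := ⨅ N : ℕ, levelK W (p ^ N)

/-- Membership in `K^{(p)}`. -/
theorem mem_levelKInf_iff (p : ℕ) (g : GA W) : g ∈ levelKInf W p ↔ ∀ N : ℕ, g ∈ levelK W (p ^ N) :=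
  Subgroup.mem_iInf

/-- The double cosets along `p`-powers are nested. -/
theorem levelDoubleCoset_pow_antitone (p : ℕ) {n m : ℕ} (h : n ≤ m) (γ₀ : GA W) :
    levelDoubleCoset W (p ^ m) γ₀ ⊆ levelDoubleCoset W (p ^ n) γ₀ :=
  levelDoubleCoset_antitone W (pow_dvd_pow p h) γ₀

/-- **`⋂_N K(p^N) γ₀ K(p^N) = K^{(p)} γ₀ K^{(p)}`** (`p ≠ 0`): the factorisations `a γ₀ c = x` with `a, c ∈ K(p^N)` form
nested non-empty compact sets, so one factorisation works at every level. -/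
theorem mem_iInter_levelDoubleCoset_pow_iff {p : ℕ} (hp : p ≠ 0) (γ₀ x : GA W) :
    (∀ N : ℕ, x ∈ levelDoubleCoset W (p ^ N) γ₀) ↔
      ∃ a ∈ levelKInf W p, ∃ c ∈ levelKInf W p, x = a * γ₀ * c := by
  haveI : T2Space (GA W) := t2Space_GA W
  constructor
  · intro h
    -- the factorisation sets at level `p^(i+1)`
    set t : ℕ → Set (GA W × GA W) := fun i =>
      {q | q.1 ∈ levelK W (p ^ (i + 1)) ∧ q.2 ∈ levelK W (p ^ (i + 1)) ∧ q.1 * γ₀ * q.2 = x} with ht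
    have htd : ∀ i, t (i + 1) ⊆ t i := by
      intro i q hq
      exact ⟨levelK_pow_antitone W p (i + 1) hq.1, levelK_pow_antitone W p (i + 1) hq.2.1, hq.2.2⟩
    have htn : ∀ i, (t i).Nonempty := by
      intro i
      obtain ⟨a, ha, c, hc, hx⟩ := exists_eq_mul_of_mem_mul_singleton_mul W _ γ₀ x (h (i + 1))
      exact ⟨(a, c), ha, hc, hx.symm⟩
    have htcl : ∀ i, IsClosed (t i) := by
      intro i
      have h1 : IsClosed {q : GA W × GA W | q.1 ∈ levelK W (p ^ (i + 1))} :=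
        (isClosed_levelK W (pow_ne_zero _ hp)).preimage continuous_fst
      have h2 : IsClosed {q : GA W × GA W | q.2 ∈ levelK W (p ^ (i + 1))} :=
        (isClosed_levelK W (pow_ne_zero _ hp)).preimage continuous_snd
      have h3 : IsClosed {q : GA W × GA W | q.1 * γ₀ * q.2 = x} :=
        isClosed_eq ((continuous_fst.mul continuous_const).mul continuous_snd) continuous_const
      have heq : t i = ({q : GA W × GA W | q.1 ∈ levelK W (p ^ (i + 1))} ∩
          {q : GA W × GA W | q.2 ∈ levelK W (p ^ (i + 1))}) ∩ {q : GA W × GA W | q.1 * γ₀ * q.2 = x} := by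
        ext q
        simp only [ht, Set.mem_setOf_eq, Set.mem_inter_iff, and_assoc]
      rw [heq]
      exact (h1.inter h2).inter h3
    have ht0 : IsCompact (t 0) := by
      have hK : IsCompact ((levelK W (p ^ (0 + 1)) : Set (GA W)) ×ˢ (levelK W (p ^ (0 + 1)) : Set (GA W))) :=
        (isCompact_levelK W (pow_ne_zero (0 + 1) hp)).prod (isCompact_levelK W (pow_ne_zero (0 + 1) hp))
      refine hK.of_isClosed_subset (htcl 0) ?_
      intro q hq
      exact ⟨hq.1, hq.2.1⟩
    obtain ⟨⟨a, c⟩, hac⟩ := IsCompact.nonempty_iInter_of_sequence_nonempty_isCompact_isClosed t htd htn ht0 htcl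
    rw [Set.mem_iInter] at hac
    refine ⟨a, ?_, c, ?_, (hac 0).2.2.symm⟩
    · rw [mem_levelKInf_iff]
      intro N
      exact levelK_pow_antitone' W p (Nat.le_succ N) (hac N).1
    · rw [mem_levelKInf_iff]
      intro N
      exact levelK_pow_antitone' W p (Nat.le_succ N) (hac N).2.1
  · rintro ⟨a, ha, c, hc, rfl⟩ N
    rw [mem_levelKInf_iff] at ha hc
    exact Set.mul_mem_mul (Set.mul_mem_mul (ha N) (Set.mem_singleton γ₀)) (hc N)

/-- **The shrinking of the level double cosets**: every open set containing `K^{(p)} γ₀ K^{(p)}` contains `K(p^N) γ₀ K(p^N)`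
from some level on. -/
theorem exists_levelDoubleCoset_pow_subset {p : ℕ} (hp : p ≠ 0) (γ₀ : GA W) {U : Set (GA W)} (hU : IsOpen U)
    (hKU : ∀ x, (∃ a ∈ levelKInf W p, ∃ c ∈ levelKInf W p, x = a * γ₀ * c) → x ∈ U) :
    ∃ N₀ : ℕ, ∀ N ≥ N₀, levelDoubleCoset W (p ^ N) γ₀ ⊆ U := by
  haveI : T2Space (GA W) := t2Space_GA W
  by_contra hcon
  push Not at hcon
  -- the closed sets `K(p^(i+1)) γ₀ K(p^(i+1)) ∖ U` are nested, non-empty, in a compact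
  set t : ℕ → Set (GA W) := fun i => levelDoubleCoset W (p ^ (i + 1)) γ₀ \ U with ht
  have htd : ∀ i, t (i + 1) ⊆ t i := fun i => Set.sdiff_subset_sdiff_left
    (levelDoubleCoset_pow_antitone W p (Nat.le_succ (i + 1)) γ₀)
  have htn : ∀ i, (t i).Nonempty := by
    intro i
    obtain ⟨N, hN, hnot⟩ := hcon (i + 1)
    obtain ⟨x, hx, hxU⟩ := Set.not_subset.1 hnot
    exact ⟨x, levelDoubleCoset_pow_antitone W p hN γ₀ hx, hxU⟩
  have htcl : ∀ i, IsClosed (t i) := fun i =>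
    (isCompact_levelDoubleCoset W (pow_ne_zero _ hp) γ₀).isClosed.sdiff hU
  have ht0 : IsCompact (t 0) :=
    (isCompact_levelDoubleCoset W (pow_ne_zero _ hp) γ₀).of_isClosed_subset (htcl 0) Set.sdiff_subset
  obtain ⟨x, hx⟩ := IsCompact.nonempty_iInter_of_sequence_nonempty_isCompact_isClosed t htd htn ht0 htcl
  rw [Set.mem_iInter] at hx
  have hall : ∀ N : ℕ, x ∈ levelDoubleCoset W (p ^ N) γ₀ := fun N =>
    levelDoubleCoset_pow_antitone W p (Nat.le_succ N) γ₀ (hx N).1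
  exact (hx 0).2 (hKU x ((mem_iInter_levelDoubleCoset_pow_iff W hp γ₀ x).1 hall))

/-- **The level fibre of the (7b) witness enters every neighbourhood of its limit**: for `U ⊇ K^{(p)} γ₀,f K^{(p)}` open,
the fibre `suppSet γ₀ (p^N) γ` lies in the preimage of `U` under the orbit map `(b, b′) ↦ b⁻¹ γ_f b′` from some level on. -/
theorem exists_suppSet_pow_subset {p : ℕ} (hp : p ≠ 0) (γ₀ γ : GA W) {U : Set (GA W)} (hU : IsOpen U)
    (hKU : ∀ x, (∃ a ∈ levelKInf W p, ∃ c ∈ levelKInf W p, x = a * GA.ofFinPart W γ₀ * c) → x ∈ U) :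
    ∃ N₀ : ℕ, ∀ N ≥ N₀, suppSet W γ₀ (p ^ N) γ ⊆
      {q : torusFin W × torusFin' W |
        (((q.1 : torusT W) : GA W))⁻¹ * GA.ofFinPart W γ * ((q.2 : torusT' W) : GA W) ∈ U} := by
  obtain ⟨N₀, hN₀⟩ := exists_levelDoubleCoset_pow_subset W hp (GA.ofFinPart W γ₀) hU hKU
  exact ⟨N₀, fun N hN q hq => hN₀ N hN hq⟩

end Shrink

end Summit.Ventures.HodgeRepro.Tier4.Line4

end
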